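import Summits.AtomisticToContinuum.Crystallization.Theses.ThreeConeCertificate
import Summits.AtomisticToContinuum.Crystallization.Theorems.ThreeConeCertificateDefs
import Summits.AtomisticToContinuum.Crystallization.Theorems.ThreeConeCertificateOnePercentCertificatePosTypeGaussBernstein
import Summits.AtomisticToContinuum.Crystallization.Theorems.ThreeConeCertificateOnePercentCertificateBernsteinTailEq
import Summits.AtomisticToContinuum.Crystallization.Theorems.ThreeConeCertificateOnePercentCertificateTailLe

/-!
# `OnePercentCertificate` (stmt-AtomisticToContinuum-11958) — reduction to the local constant (line `Sketch`)

The crux `OnePercentCertificate` of route `ThreeConeCertificate` (∃ split `V_LJ = g + U + f` at range `5/2` with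
value `c + f 0/2 ≤ 29/40`) REDUCES to one statement about the explicit Bernstein/Gaussian split of
`Theorems/ThreeConeCertificateDefs.lean` (`fS`, `gS`, `US`, `cS`): the finite-range part `gS` is `cS`-stable,
`∀ N x, Injective x → −(cS·N) ≤ Σ_{i<j} gS(|x_i − x_j|)` (`cS = 29/40 − fS 0/2 ≈ 0.657987`).  Everything else —
positive type of `fS` (via the landed `stub_posType_gaussBernstein` and the symbol inequality of the nested
design, `21997/219700 ≥ 3/729 + 12/125`), the slack sign on `[5/2,∞)` (landed `stub_bernsteinTail_eq`,
`stub_tail_le`), decomposition, range and value — is proved here: `onePercentCertificate_of_local`.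
The remaining statement is the line's registered stub `stub_local` (Kepler/Flyspeck-scale: a 1 %-sharp
energetic lower bound for a finite-range Lennard-Jones surrogate over all finite configurations).
-/

noncomputable section

open scoped BigOperators
open MeasureTheory intervalIntegral
open Literature.MathematicalPhysics.StatisticalMechanics
open Summit.AtomisticToContinuum.Crystallization.Theorems
open Summit.AtomisticToContinuum.Crystallization.Theorems.ThreeConeSplit

namespace Summit.AtomisticToContinuum.Crystallization.Theorems.OnePercentReduction


/-! ## Composition -/

/-- The two Gaussian rates `169/100`, `81/100` are positive. [folklore] -/
theorem tS_pos : ∀ m, 0 < (![169 / 100, 81 / 100] : Fin 2 → ℝ) m := by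
  intro m
  fin_cases m <;> simp

/-- `fS` as a `Fin 2` signed Gaussian mixture minus the Bernstein tail piece. [folklore] -/
theorem fS_eq_atoms (r : ℝ) :
    fS r = (∑ m, (![21997 / 100000, -(3 / 1000)] : Fin 2 → ℝ) m * Real.exp (-((![169 / 100, 81 / 100] : Fin 2 → ℝ) m) * r ^ 2)) - 1 / 12 * bernsteinTail (36 / 25) r := by
  simp only [fS, Fin.sum_univ_two, Matrix.cons_val_zero, Matrix.cons_val_one]
  ring

/-- `√(169/100) = 13/10`. [folklore] -/
theorem sqrt_tS_zero : Real.sqrt ((![169 / 100, 81 / 100] : Fin 2 → ℝ) 0) = 13 / 10 := by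
  rw [show (![169 / 100, 81 / 100] : Fin 2 → ℝ) 0 = (13 / 10) ^ 2 by norm_num]
  exact Real.sqrt_sq (by norm_num)

/-- `√(81/100) = 9/10`. [folklore] -/
theorem sqrt_tS_one : Real.sqrt ((![169 / 100, 81 / 100] : Fin 2 → ℝ) 1) = 9 / 10 := by
  rw [show (![169 / 100, 81 / 100] : Fin 2 → ℝ) 1 = (9 / 10) ^ 2 by norm_num]
  exact Real.sqrt_sq (by norm_num)

/-- `∫₀^{36/25} √u du = 144/125`. -/
theorem integral_sqrt_T : ∫ u in (0 : ℝ)..(36 / 25), Real.sqrt u = 144 / 125 := by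
  have h := @integral_rpow 0 (36 / 25) (1 / 2) (Or.inl (by norm_num))
  simp_rw [← Real.sqrt_eq_rpow] at h
  rw [h]
  norm_num

/-- The symbol inequality of the nested design: for `s ≥ 0`,
`(1/12)∫₀ᵀ √u e^{−s/u} du ≤ A (13/10)⁻³ e^{−s/a} − B (9/10)⁻³ e^{−s/b}`. -/
theorem symbol_ineq (s : ℝ) (hs : 0 ≤ s) :
    1 / 12 * ∫ u in (0 : ℝ)..(36 / 25), Real.sqrt u * Real.exp (-s / u)
      ≤ ∑ m, (![21997 / 100000, -(3 / 1000)] : Fin 2 → ℝ) m / Real.sqrt ((![169 / 100, 81 / 100] : Fin 2 → ℝ) m) ^ 3 * Real.exp (-s / (![169 / 100, 81 / 100] : Fin 2 → ℝ) m) := by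
  -- Step 1: on `[0, T]`, `√u e^{−s/u} ≤ √u e^{−s/a}` (`u ≤ T ≤ a`).
  have hpt : ∀ u ∈ Set.Icc (0 : ℝ) (36 / 25),
      Real.sqrt u * Real.exp (-s / u) ≤ Real.sqrt u * Real.exp (-s / (169 / 100)) := by
    intro u hu
    rcases eq_or_lt_of_le hu.1 with h0 | hpos
    · subst h0; simp
    · refine mul_le_mul_of_nonneg_left (Real.exp_le_exp.2 ?_) (Real.sqrt_nonneg u)
      rw [neg_div, neg_div, neg_le_neg_iff]
      exact div_le_div_of_nonneg_left hs hpos (by linarith [hu.2])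
  have hint1 : IntervalIntegrable (fun u => Real.sqrt u * Real.exp (-s / u)) volume 0 (36 / 25) := by
    rw [intervalIntegrable_iff_integrableOn_Icc_of_le (by norm_num)]
    refine Measure.integrableOn_of_bounded (M := 6 / 5) measure_Icc_lt_top.ne ?_ ?_
    · exact ((Real.continuous_sqrt.measurable).mul
        (Real.measurable_exp.comp (measurable_const.div measurable_id))).aestronglyMeasurable
    · rw [ae_restrict_iff' measurableSet_Icc]
      refine Filter.Eventually.of_forall fun u hu => ?_
      rw [Real.norm_eq_abs, abs_of_nonneg (mul_nonneg (Real.sqrt_nonneg u) (Real.exp_pos _).le)]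
      have h1 : Real.sqrt u ≤ 6 / 5 := by
        rw [show (6 / 5 : ℝ) = Real.sqrt ((6 / 5) ^ 2) from (Real.sqrt_sq (by norm_num)).symm]
        exact Real.sqrt_le_sqrt (by nlinarith [hu.2])
      have h2 : Real.exp (-s / u) ≤ 1 := by
        rcases eq_or_lt_of_le hu.1 with h0 | hpos
        · subst h0; simp
        · exact Real.exp_le_one_iff.2 (by rw [neg_div]; exact neg_nonpos.2 (div_nonneg hs hpos.le))
      calc Real.sqrt u * Real.exp (-s / u) ≤ 6 / 5 * 1 :=
            mul_le_mul h1 h2 (Real.exp_pos _).le (by norm_num)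
        _ = 6 / 5 := by norm_num
  have hint2 : IntervalIntegrable (fun u => Real.sqrt u * Real.exp (-s / (169 / 100))) volume 0 (36 / 25) :=
    (Real.continuous_sqrt.mul continuous_const).intervalIntegrable _ _
  have hmono := intervalIntegral.integral_mono_on (by norm_num) hint1 hint2 hpt
  rw [intervalIntegral.integral_mul_const, integral_sqrt_T] at hmono
  -- Step 2: the right-hand side, with `e^{−s/b} ≤ e^{−s/a}`.
  have hexp : Real.exp (-s / (81 / 100)) ≤ Real.exp (-s / (169 / 100)) := by
    refine Real.exp_le_exp.2 ?_
    rw [neg_div, neg_div, neg_le_neg_iff]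
    exact div_le_div_of_nonneg_left hs (by norm_num) (by norm_num)
  simp only [Fin.sum_univ_two, Matrix.cons_val_zero, Matrix.cons_val_one]
  rw [show Real.sqrt (169 / 100) = 13 / 10 from sqrt_tS_zero,
    show Real.sqrt (81 / 100) = 9 / 10 from sqrt_tS_one]
  have hE := Real.exp_pos (-s / (169 / 100))
  nlinarith [hmono, hexp, hE]

/-- `fS ≤ V_LJ` on `[5/2, ∞)` (from the closed form `stub_bernsteinTail_eq` and the univariate
inequality `stub_tail_le`). -/
theorem fS_le_lennardJones (r : ℝ) (hr : 5 / 2 ≤ r) : fS r ≤ lennardJones r := by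
  have hr0 : 0 < r := by linarith
  have h := stub_tail_le r hr
  rw [fS, bernsteinTail, stub_bernsteinTail_eq (36 / 25) r (by norm_num) hr0]
  simpa [neg_mul] using h

/-- `fS` is of positive type on `ℝ³` (from `stub_posType_gaussBernstein` and the symbol inequality
of the nested design). -/
theorem fS_posType (n : ℕ) (y : Fin n → EuclideanSpace ℝ (Fin 3)) (w : Fin n → ℝ) :
    0 ≤ ∑ i, ∑ j, w i * w j * fS (dist (y i) (y j)) := by
  have h := stub_posType_gaussBernstein (![21997 / 100000, -(3 / 1000)] : Fin 2 → ℝ) (![169 / 100, 81 / 100] : Fin 2 → ℝ) tS_pos (1 / 12) (36 / 25) (by norm_num) (by norm_num)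
    symbol_ineq n y w
  simpa only [fS_eq_atoms, bernsteinTail] using h

/-- **Composition.** The four stubs give the crux `OnePercentCertificate` by name, with the
witnesses `c := cS`, `g := gS`, `U := US`, `f := fS`: (1) the decomposition on `(0,∞)` and (3) the
range are definitional case splits, (2) the slack sign is `fS ≤ V_LJ` on the tail, (4) positive
type is `fS_posType`, (5) is `stub_local`, (6) the value is `cS + fS 0 / 2 = 29/40` by definition
of `cS`. -/
theorem onePercentCertificate_of_local
    (h_local : ∀ (N : ℕ) (x : Fin N → EuclideanSpace ℝ (Fin 3)), Function.Injective x →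
      -(cS * (N : ℝ)) ≤ interactionEnergy gS x) :
    Summit.AtomisticToContinuum.Crystallization.Theses.ThreeConeCertificate.OnePercentCertificate := by
  refine ⟨cS, gS, US, fS, fun r _ => lennardJones_eq_gS_add_US_add_fS r, ?_, fun r hr => gS_eq_zero hr,
    fS_posType, h_local, (cS_add_fS_zero_div_two).le⟩
  -- (2) slack sign
  intro r _
  simp only [US]
  split_ifs with h
  · exact le_rfl
  · exact sub_nonneg.2 (fS_le_lennardJones r (not_lt.1 h))

end Summit.AtomisticToContinuum.Crystallization.Theorems.OnePercentReduction
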